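import Summits.PneNP.PneNP.Theorems.SymmetryBudgetNoHiddenOrderProgramSrcsD
import Summits.PneNP.PneNP.Theorems.SymmetryBudgetNoHiddenOrderProgramSrcsCSym

/-!
# `NoHiddenOrder` (stmt-PneNP-14781), (R2c) VI: the window canoniser program — the dispatch is symmetric

Route `PneNP/SymmetryBudget`; companion of `…ProgramSrcsD.lean` (seat -1's dispatch `WCanon.kind` / `WCanon.srcs` on the gate type `Gt m`).
Assembling the shape lemmas of `…ProgramSrcsASym/BSym/CSym.lean`: for every budget permutation `ρ ∈ Bud(m, ⌊log₂ m⌋)`, with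
`σ := budgetPerm ρ hρ` and the wire map `Fw hρ = Sum.map (diagMap ρ) (Gt.perm ρ σ)`,

* `kind_relabel : kind (l.relabel ρ σ) = kind l` (any `ρ`, `σ`);
* `srcs_image : (srcs l).image (Fw hρ) = srcs (l.relabel ρ (budgetPerm ρ hρ))` — including the root gates `adjW/adjO` (the input matrix is
  read through `diagMap ρ`), the output helpers `woc` (the root label and the window positions are fixed: `relabel_rootLabOf`, `wposW_apply`)
  and the OUTPUT gates `out q`, which are FIXED (`Gt.perm_out`) with invariant source sets because `ρ` fixes the ordered indices;
* hence **`isSym_of`**: every `P : SymProg (Fin m × Fin m) (Gt m)` with `P.kind = kind` and `P.srcs = srcs` (the rank is irrelevant) satisfies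
  `P.IsSym (diagMap ρ) (Gt.perm ρ (budgetPerm ρ hρ))`, and **`isSym_θw`**: `P.IsSym (diagMap ρ) (θw m ρ)` — the `isSym` field of
  `GraphProgram` with `θ := θw m` (and `out_fixed := θw_out`).
Sorry-free; supports stmt-PneNP-14781, does not close it.
-/

set_option linter.dupNamespace false -- `Summit.PneNP.PneNP.…` (D-0017 single-conjunct layout)

namespace Summit.PneNP.PneNP.Theorems

open Finset CGBits BranchSum Literature.Computability.Complexity Literature.Computability.Complexity.SymProg

namespace WCanon

variable {m : ℕ}

/-! ### Kinds -/

/-- **The kind of a gate is invariant under relabelling.** [folklore] -/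
theorem kind_relabel (ρ : Equiv.Perm (Fin m)) (σ : Equiv.Perm (WV m)) (l : Gt m) : kind (l.relabel ρ σ) = kind l := by
  cases l <;> simp only [kind, Gt.relabel, vsKind_relabel, riKind_relabel, anKind_relabel, trKind_relabel, orKind_relabel, andKind_relabel]

/-! ### Root label and window positions -/

/-- The root label at a window vertex moves to the root label at its image (both are `rootLab m _`). [folklore] -/
theorem relabel_rootLabOf (σ : Equiv.Perm (WV m)) (u : WV m) : FLab.relabel σ (rootLabOf u) = rootLabOf (σ u) :=
  FLab.relabel_rootLab σ (wn_pos u)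

/-- The window position of an index does not depend on the witnessing window vertex. [folklore] -/
theorem wposW_apply (u u' : WV m) (a : Fin m) : wposW u a = wposW u' a := rfl

/-- Two root labels are equal. [folklore] -/
theorem rootLab_eq (h h' : 0 < wn m) : rootLab m h = rootLab m h' := rfl

/-! ### Sources -/

section Srcs

variable {ρ : Equiv.Perm (Fin m)} (hρ : ρ ∈ pointStabiliserBudget m (Nat.log 2 m))

/-- The wire map on an input wire. -/
theorem Fw_inl (q : Fin m × Fin m) : Fw hρ (Sum.inl q) = Sum.inl (ρ q.1, ρ q.2) := rfl

/-- The wire map on an internal gate. -/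
theorem Fw_inr (g : Gt m) : Fw hρ (Sum.inr g) = Sum.inr (g.relabel ρ (budgetPerm ρ hρ)) := rfl

/-- **The source sets are equivariant under a budget permutation.** [folklore] -/
theorem srcs_image (l : Gt m) : (srcs l).image (Fw hρ) = srcs (l.relabel ρ (budgetPerm ρ hρ)) := by
  cases l with
  | tt => rfl
  | ff => rfl
  | adjW u v =>
    simp only [srcs, Gt.relabel, EmbeddingLike.apply_eq_iff_eq]
    split_ifs
    · rfl
    · simp only [image_insert, image_singleton, Fw_inl, coe_budgetPerm]
  | adjO u b =>
    simp only [srcs, Gt.relabel, coe_budgetPerm, EmbeddingLike.apply_eq_iff_eq]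
    split_ifs
    · rfl
    · simp only [image_insert, image_singleton, Fw_inl]
  | sig g => exact vsSrcs_sigW_image hρ g
  | root g => exact riSrcs_rootIn_image hρ g
  | an L k g => exact anSrcs_stIn_image _ ρ _ L k g
  | tr L k g => exact trSrcs_stIn_image _ ρ _ L k g
  | vor L g => exact orSrcs_image _ ρ _ L g
  | vand L g => exact andSrcs_image _ ρ _ L g
  | vl L g => exact vlSrcs_image _ ρ _ L g
  | woc a b u c =>
    simp only [srcs, Gt.relabel, image_insert, image_singleton, Fw_inr, RIGate.relabel, relabel_rootLabOf]
    rfl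
  | out q =>
    show (srcs (Gt.out q)).image (Fw hρ) = srcs (Gt.out q)
    simp only [srcs]
    split_ifs with ha hb hb' hq
    · simp only [image_singleton, Fw_inr, Gt.relabel, FLab.relabel_rootLab]
    · refine image_image_univ_cκ (budgetPerm ρ hρ) _ _ _ (fun uc => ?_)
      simp only [Fw_inr, Gt.relabel, apply_eq_self_of_not_mem_windowSet hρ hb]
      rfl
    · refine image_image_univ_cκ (budgetPerm ρ hρ) _ _ _ (fun uc => ?_)
      simp only [Fw_inr, Gt.relabel, apply_eq_self_of_not_mem_windowSet hρ ha]
      rfl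
    · rfl
    · simp only [image_insert, image_singleton, Fw_inl, apply_eq_self_of_not_mem_windowSet hρ ha,
        apply_eq_self_of_not_mem_windowSet hρ hb', Prod.mk.eta]

/-! ### The symmetry of the dispatch -/

/-- **Every program with this kind and source dispatch is symmetric under the budget**, with `θ ρ := Gt.perm ρ (budgetPerm ρ hρ)`
(the rank function is irrelevant). [folklore] -/
theorem isSym_of (P : SymProg (Fin m × Fin m) (Gt m)) (hk : ∀ l, P.kind l = kind l) (hs : ∀ l, P.srcs l = srcs l) :
    P.IsSym (diagMap ρ) (Gt.perm ρ (budgetPerm ρ hρ)) := by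
  refine ⟨fun l => ?_, fun l => ?_⟩
  · rw [hk, hk, Gt.perm_apply, kind_relabel]
  · rw [hs, hs, Gt.perm_apply, ← srcs_image hρ l]

include hρ in
/-- **The same with the total symmetry data `θw m`** (the `isSym` field of `GraphProgram` for `θ := θw m`; `out_fixed` is `θw_out`).
[folklore] -/
theorem isSym_θw (P : SymProg (Fin m × Fin m) (Gt m)) (hk : ∀ l, P.kind l = kind l) (hs : ∀ l, P.srcs l = srcs l) :
    P.IsSym (diagMap ρ) (θw m ρ) := by
  rw [θw_eq hρ]
  exact isSym_of hρ P hk hs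

end Srcs

end WCanon

end Summit.PneNP.PneNP.Theorems
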